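import Summits.MatrixMultiplication.MatrixMultiplication.Theorems.SoloBlindSeparability
import HarnessLib

/-!
# Abelian realizations of `T_xyz^{⊠N}` in groups of exponent two need `|H| ≥ 4^N`

Fourth rung of the solo-blind realization line (`SoloBlindAbelianRealization`: a realization of the
support of `T_xyz^{⊠N}` in a finite abelian group `H` gives `R(T_{cw,2}^{⊠N}) ≤ |H|`, and the product
realization in `(ℤ/2 × ℤ/2)^N` gives `4^N`; `SoloBlindSeparability`: realizing maps are separable).

**Theorem** (`four_pow_le_card_of_xyzRealization_of_exponent_two`). If every element of `H` has order
`≤ 2` and `s : (Fin N → Fin 3) → H`, `u : H` realize `T_xyz^{⊠N}`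
(`s a + s b + s c = u ↔ a, b, c coordinatewise pairwise distinct`), then `4 ^ N ≤ |H|`.

So inside the class of elementary abelian `2`-groups the Klein realization is optimal and the
realization bound on `R(T_{cw,2}^{⊠N})` is exactly `4^N = bR(T_{cw,2})^N`: beating `4^N` by an abelian
realization — the only way this line could lower the asymptotic rank of `T_{cw,2}` below `4` — requires
group elements of order `> 2`.

Proof. By separability `s x = c₀ + ∑ i, tᵢ(xᵢ)` with `tᵢ = (0, pᵢ, qᵢ)`. For `λ, μ ∈ {0,1}^N` put
`Φ(λ, μ) = ∑ i, (λᵢ pᵢ + μᵢ qᵢ)`. The triple `a = 0`, `bᵢ = [λᵢ = μᵢ = 0]`, `cᵢ = 2` if `μᵢ = 0`, else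
`1 - λᵢ`, has coordinate patterns `(0,1,2), (0,0,2), (0,0,1), (0,0,0)` according to `(λᵢ, μᵢ)`, whose
`t`-sums are `pᵢ+qᵢ, qᵢ, pᵢ, 0 = (pᵢ + qᵢ) + (λᵢ pᵢ + μᵢ qᵢ)` in exponent two; hence
`s a + s b + s c = u + Φ(λ, μ)`, and `Φ(λ, μ) = 0` forces every pattern to be a permutation, i.e.
`λ = μ = 0`. In exponent two `Φ(λ,μ) + Φ(λ',μ') = Φ(λ ⊕ λ', μ ⊕ μ')`, so `Φ` is injective on a set of
size `4^N`. ∎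
-/

open scoped BigOperators

namespace Summit.MatrixMultiplication.MatrixMultiplication.Theorems

set_option linter.dupNamespace false

section ExponentTwo

variable {H : Type*} [AddCommGroup H]

/-- In exponent two, two indicator multiples of `x` add to the indicator multiple for the XOR. [new] -/
theorem ite_add_ite_eq_ite_bne (h2 : ∀ x : H, x + x = 0) (x : H) (b b' : Bool) :
    ((if b then x else 0) + if b' then x else 0) = if (b != b') then x else 0 := by
  cases b <;> cases b' <;> simp [h2 x]

/-- The one-coordinate bookkeeping: the `t`-sum of the pattern attached to `(l, m)` equals
`(p + q) + (l·p + m·q)` in exponent two. [new] -/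
theorem coordPattern_tsum (h2 : ∀ x : H, x + x = 0) (p q : H) (l m : Bool) :
    (![0, p, q] : Fin 3 → H) 0 +
        (![0, p, q] : Fin 3 → H) (if (!l && !m) then 1 else 0) +
        (![0, p, q] : Fin 3 → H) (if m then (if l then 0 else 1) else 2) =
      (p + q) + ((if l then p else 0) + if m then q else 0) := by
  have e1 : ∀ x y : H, x + y + x = y := fun x y => by
    rw [add_comm x y, add_assoc, h2, add_zero]
  have e2 : ∀ x y : H, x + y + y = x := fun x y => by rw [add_assoc, h2, add_zero]
  have e3 : ∀ x y : H, x + y + (x + y) = 0 := fun x y => h2 (x + y)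
  cases l <;> cases m <;> simp [e1, e2, e3]

/-- **No-go in exponent two.** An abelian realization of the support of `T_xyz^{⊠N}` in a finite
abelian group all of whose elements have order `≤ 2` has `|H| ≥ 4^N`. [new] -/
theorem four_pow_le_card_of_xyzRealization_of_exponent_two {N : ℕ} [Fintype H]
    (h2 : ∀ x : H, x + x = 0) (s : (Fin N → Fin 3) → H) (u : H)
    (h : ∀ a b c : Fin N → Fin 3, s a + s b + s c = u ↔ ∀ i, a i ≠ b i ∧ b i ≠ c i ∧ a i ≠ c i) :
    4 ^ N ≤ Fintype.card H := by
  classical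
  obtain ⟨c₀, p, q, hs⟩ :=
    exists_params_of_sum_const_on_support s u (fun a b c habc => (h a b c).2 habc)
  -- the word map
  let Φ : (Fin N → Bool) × (Fin N → Bool) → H :=
    fun lm => ∑ i, ((if lm.1 i then p i else 0) + if lm.2 i then q i else 0)
  -- the target in terms of the parameters (the constant words 0…0, 1…1, 2…2 form a support triple)
  have hu : u = c₀ + c₀ + c₀ + ∑ i, (p i + q i) := by
    have h012 := (h (fun _ => 0) (fun _ => 1) (fun _ => 2)).2 (fun i => by decide)
    rw [← h012, hs, hs, hs]
    simp only [Matrix.cons_val_zero, Matrix.cons_val_one, Matrix.head_cons, Matrix.cons_val_two,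
      Matrix.tail_cons, Finset.sum_const_zero, add_zero, Finset.sum_add_distrib]
    abel
  -- Φ(λ, μ) = 0 forces λ = μ = 0
  have key : ∀ l m : Fin N → Bool, Φ (l, m) = 0 → ∀ i, l i = false ∧ m i = false := by
    intro l m h0
    let a : Fin N → Fin 3 := fun _ => 0
    let b : Fin N → Fin 3 := fun i => if (!l i && !m i) then 1 else 0
    let c : Fin N → Fin 3 := fun i => if m i then (if l i then 0 else 1) else 2
    have hsum : s a + s b + s c = u := by
      have hcoord : ∀ i, (![0, p i, q i] : Fin 3 → H) (a i) + (![0, p i, q i] : Fin 3 → H) (b i) +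
          (![0, p i, q i] : Fin 3 → H) (c i) = (p i + q i) + ((if l i then p i else 0) +
            if m i then q i else 0) := fun i => coordPattern_tsum h2 (p i) (q i) (l i) (m i)
      have hΦ : ∑ i, ((if l i then p i else 0) + if m i then q i else 0) = 0 := h0
      rw [hs, hs, hs, hu]
      calc c₀ + ∑ i, (![0, p i, q i] : Fin 3 → H) (a i) + (c₀ + ∑ i, (![0, p i, q i] : Fin 3 → H) (b i))
            + (c₀ + ∑ i, (![0, p i, q i] : Fin 3 → H) (c i))
          = c₀ + c₀ + c₀ + ∑ i, ((![0, p i, q i] : Fin 3 → H) (a i) +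
              (![0, p i, q i] : Fin 3 → H) (b i) + (![0, p i, q i] : Fin 3 → H) (c i)) := by
            rw [Finset.sum_add_distrib, Finset.sum_add_distrib]; abel
        _ = c₀ + c₀ + c₀ + ∑ i, ((p i + q i) + ((if l i then p i else 0) +
              if m i then q i else 0)) := by
            rw [Finset.sum_congr rfl fun i _ => hcoord i]
        _ = c₀ + c₀ + c₀ + ∑ i, (p i + q i) := by
            rw [Finset.sum_add_distrib, hΦ, add_zero]
    have hd := (h a b c).1 hsum
    intro i
    obtain ⟨hab, -, -⟩ := hd i
    have hab' : (0 : Fin 3) ≠ (if (!l i && !m i) then 1 else 0) := hab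
    revert hab'
    cases l i <;> cases m i <;> simp
  -- Φ is injective
  have hinj : Function.Injective Φ := by
    rintro ⟨l, m⟩ ⟨l', m'⟩ hΦ
    have hx : Φ (fun i => l i != l' i, fun i => m i != m' i) = 0 := by
      have hadd : Φ (l, m) + Φ (l', m') = Φ (fun i => l i != l' i, fun i => m i != m' i) := by
        show (∑ i, ((if l i then p i else 0) + if m i then q i else 0)) +
            (∑ i, ((if l' i then p i else 0) + if m' i then q i else 0)) =
            ∑ i, ((if (l i != l' i) then p i else 0) + if (m i != m' i) then q i else 0)
        rw [← Finset.sum_add_distrib]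
        refine Finset.sum_congr rfl fun i _ => ?_
        rw [add_add_add_comm, ite_add_ite_eq_ite_bne h2, ite_add_ite_eq_ite_bne h2]
      rw [← hadd, hΦ, h2]
    have hk := key _ _ hx
    have hl : l = l' := funext fun i => by
      have := (hk i).1; revert this; cases l i <;> cases l' i <;> simp
    have hm : m = m' := funext fun i => by
      have := (hk i).2; revert this; cases m i <;> cases m' i <;> simp
    rw [hl, hm]
  calc 4 ^ N = Fintype.card ((Fin N → Bool) × (Fin N → Bool)) := by
        rw [Fintype.card_prod, Fintype.card_fun, Fintype.card_bool, Fintype.card_fin, ← mul_pow]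
        norm_num
    _ ≤ Fintype.card H := Fintype.card_le_of_injective Φ hinj

end ExponentTwo

end Summit.MatrixMultiplication.MatrixMultiplication.Theorems
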